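import Literature.AnabelianGeometry.EtaleTheta.GalSectIntegralStructures
import HarnessLib

/-!
# [GalSect] §4 / Def. 4.1 (i)(ii): the change-of-structure-group torsor IS a torsor; orbit structures —
# proof-only companion of `GalSectCuspidalTorsors.lean` / `GalSectIntegralStructures.lean`

Mochizuki, *Galois sections in absolute anabelian geometry* [GalSect], Nagoya Math. J. **179** (2005),
§4 p.33 and Def. 4.1 (i)(ii) pp.33–34 [cite: MochizukiGalSect2005, Def 4.1 p.33].  abc-iut cell, layer L2,
row «N5 UNBLOCK [GalSect] §4 vocabulary» (seat abc-iut-w5-d062 gen 2).  PROOF-ONLY (no definitions, no named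
facts): the elementary torsor algebra print uses silently when it speaks of "the `A`-torsor at `x`" obtained
"by changing the structure group" and of "reductions of structure group":

* `SplittingClass.mk_eq_mk_iff` — two splittings have the same class iff they are `I_x`-conjugate;
* `ATorsor.exists_act_ofClass_eq` — every point of `A ×^{(K^×)^∧} T` is `a · [c]` for the image `[c]` of a
  splitting class: the `A`-action is generated from the structure map;
* `ATorsor.existsUnique_act_eq` — **the `A`-torsor at `x` is an `A`-torsor**: `A` acts freely and
  transitively (from the free transitive action of `(K^×)^∧` on splitting classes, `CuspidalTorsorData`);
* `ATorsor.ofClass_injective_of_injective` / `ofClass_surjective_of_surjective` — along an injective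
  (resp. surjective) `φ` the structure map is injective (resp. surjective); for `φ = id` it is a bijection
  (`ofClass_bijective_id`): the `(K^×)^∧`-torsor "at `x`" of Def. 4.1 (i) is the torsor of splittings;
* `IsStructure.nonempty`, `isStructure_orbit` — a `B`-structure is nonempty, and the `B`-orbit of any
  class is a `B`-structure (so integral / discrete structures EXIST at every class: `isIntegralStructure_orbit`,
  `isDiscreteStructure_orbit`);
* `classesOf_mono` and `classesOf_canonicalIntegral_subset` — L3's `canonicalIntegral ⊆ canonicalDiscrete`
  passes to classes;
* [EtTh] Thm. 1.6 (iii) proof, p.251 l.31–38 «reduction of indeterminacy from `(K̈^×)^∧` to `O^×_K̈`»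
  (sub-DAG row L15 of plan/L2/SUBDAG-EtTh-Thm16.md, abc-iut-L6-d5): over the cusp-evaluation carrier
  `ThetaSetting.CuspidalPointDd` — `evalAt_res_kum_mul` (evaluating `kumYdd(a) · x` multiplies the value by
  `a`) and `kum_factor_mem_units_of_cuspValues`: if two classes differing by the Kummer class of
  `a ∈ (K̈^×)^∧` both evaluate at the same cusp to `O^×_K̈`-multiples of values of the same absolute value,
  then `a ∈ K̈^×` is a UNIT (PROVED; the two "both evaluate" hypotheses are what Prop. 1.4 (iii) /
  `Prop14iiiCuspValues` and its `γ`-transport supply).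

HONEST FRAMING: classical torsor bookkeeping; [GalSect] is refereed; nothing here bears on [IUTchIII]
Cor. 3.12; typed ≠ endorsed.
-/

namespace Literature.AnabelianGeometry.EtaleTheta

namespace GalSect

open Literature.AnabelianGeometry.SemiGraphs
open scoped Pointwise

variable {p : ℕ} [Fact p.Prime] {X : TemperedCurve p} {x : X.Pt}

/-! ### Splitting classes -/

/-- Two splittings have the same class iff they are `I_x`-conjugate. [cite: MochizukiGalSect2005, §4 p.33] -/
theorem SplittingClass.mk_eq_mk_iff {S T : Subgroup X.PiTemp} (hS : S ∈ splittings X x)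
    (hT : T ∈ splittings X x) :
    SplittingClass.mk S hS = SplittingClass.mk T hT ↔ InertiaConj X x S T :=
  Quotient.eq (r := splittingSetoid X x)

/-- `classesOf` is monotone. [cite: MochizukiGalSect2005, Def 4.1 (iii) p.34] -/
theorem classesOf_mono {𝒮 𝒯 : Set (Subgroup X.PiTemp)} (h : 𝒮 ⊆ 𝒯) :
    (classesOf 𝒮 : Set (SplittingClass X x)) ⊆ classesOf 𝒯 := by
  rintro c ⟨S, hS, hmem, rfl⟩
  exact ⟨S, hS, h hmem, rfl⟩

/-- L3's `canonicalIntegral x ⊆ canonicalDiscrete x` (`CuspidalStructures.canonicalIntegral_subset`) on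
classes: the canonical integral structure lies inside the canonical discrete structure.
[cite: MochizukiGalSect2005, Def 4.1 (iii) p.34] -/
theorem classesOf_canonicalIntegral_subset (SX : CuspidalStructures X) :
    (classesOf (SX.canonicalIntegral x) : Set (SplittingClass X x)) ⊆ classesOf (SX.canonicalDiscrete x) :=
  classesOf_mono (SX.canonicalIntegral_subset x)

/-- A splitting whose class lies in `R` is a member of `subgroupsOf R`, and conversely `classesOf` of
`subgroupsOf R` recovers `R`. [cite: MochizukiGalSect2005, Def 4.1 (i) p.33] -/
theorem classesOf_subgroupsOf (R : Set (SplittingClass X x)) : classesOf (subgroupsOf R) = R := by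
  ext c
  constructor
  · rintro ⟨S, hS, ⟨hS', hmem⟩, rfl⟩
    exact hmem
  · intro hc
    obtain ⟨S, hS, rfl⟩ := SplittingClass.exists_rep c
    exact ⟨S, hS, ⟨hS, hc⟩, rfl⟩

namespace CuspidalTorsorData

variable (T : CuspidalTorsorData X x)

/-! ### The action of `(K^×)^∧` on splitting classes: elementary consequences of "torsor" -/

/-- Freeness: `k · c = c` forces `k = 1`. [cite: MochizukiGalSect2005, §4 p.33] -/
theorem act_eq_self_iff (k : KxHat X) (c : SplittingClass X x) : T.act k c = c ↔ k = 1 := by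
  constructor
  · intro h
    obtain ⟨k₀, -, huniq⟩ := T.existsUnique_act_eq c c
    rw [huniq k h, huniq 1 (T.act_one c)]
  · rintro rfl
    exact T.act_one c

/-- Freeness, two-sided: `k · c = k′ · c` forces `k = k′`. [cite: MochizukiGalSect2005, §4 p.33] -/
theorem act_injective_left (c : SplittingClass X x) : Function.Injective fun k => T.act k c := by
  intro k k' h
  obtain ⟨k₀, -, huniq⟩ := T.existsUnique_act_eq c (T.act k c)
  have h1 := huniq k rfl
  have h2 := huniq k' h.symm
  rw [h1, h2]

/-- Transitivity: any two classes differ by some `k`. [cite: MochizukiGalSect2005, §4 p.33] -/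
theorem exists_act_eq (c c' : SplittingClass X x) : ∃ k : KxHat X, T.act k c = c' :=
  (T.existsUnique_act_eq c c').exists

/-- Each `k` acts by a bijection (inverse `k⁻¹`). [cite: MochizukiGalSect2005, §4 p.33] -/
theorem act_bijective (k : KxHat X) : Function.Bijective (T.act k) := by
  refine Function.bijective_iff_has_inverse.mpr ⟨T.act k⁻¹, fun c => ?_, fun c => ?_⟩
  · rw [← T.act_mul, inv_mul_cancel, T.act_one]
  · rw [← T.act_mul, mul_inv_cancel, T.act_one]

/-! ### Def. 4.1 (i): the `A`-torsor at `x` is an `A`-torsor -/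

section ATorsor

variable {A : Type*} [Group A] (φ : KxHat X →* A)

/-- Every point of the `A`-torsor is `a · [c]` for a splitting class `c`: `[(a, c)] = a · [(1, c)]` — PROVED.
[cite: MochizukiGalSect2005, Def 4.1 (i) p.33] -/
theorem ATorsor.exists_act_ofClass_eq (t : T.ATorsor φ) :
    ∃ (a : A) (c : SplittingClass X x), ATorsor.act T φ a (ATorsor.ofClass T φ c) = t := by
  induction t using Quotient.inductionOn with
  | h s =>
    refine ⟨s.1, s.2, ?_⟩
    change ATorsor.act T φ s.1 (ATorsor.mk T φ 1 s.2) = ATorsor.mk T φ s.1 s.2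
    rw [ATorsor.act_mk, mul_one]

/-- The relation on representatives: `[(a, c)] = [(a′, c′)]` iff `∃ k, a′ = a·φ(k)⁻¹ ∧ c′ = k·c`.
[cite: MochizukiGalSect2005, Def 4.1 (i) p.33] -/
theorem ATorsor.mk_eq_mk_iff (a a' : A) (c c' : SplittingClass X x) :
    ATorsor.mk T φ a c = ATorsor.mk T φ a' c' ↔ ∃ k : KxHat X, a' = a * (φ k)⁻¹ ∧ c' = T.act k c :=
  Quotient.eq (r := T.pushoutSetoid φ)

/-- Transitivity of the `A`-action on the `A`-torsor. [cite: MochizukiGalSect2005, Def 4.1 (i) p.33] -/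
theorem ATorsor.exists_act_eq (t t' : T.ATorsor φ) : ∃ a : A, ATorsor.act T φ a t = t' := by
  obtain ⟨a, c, rfl⟩ := ATorsor.exists_act_ofClass_eq T φ t
  obtain ⟨a', c', rfl⟩ := ATorsor.exists_act_ofClass_eq T φ t'
  obtain ⟨k, rfl⟩ := T.exists_act_eq c c'
  -- `a' · [k·c] = a' · φ(k) · [c] = (a' φ(k) a⁻¹) · (a · [c])`
  refine ⟨a' * φ k * a⁻¹, ?_⟩
  rw [ATorsor.ofClass_act, ← ATorsor.act_mul, ← ATorsor.act_mul, inv_mul_cancel_right]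

/-- Freeness of the `A`-action on the `A`-torsor. [cite: MochizukiGalSect2005, Def 4.1 (i) p.33] -/
theorem ATorsor.act_eq_self_iff (a : A) (t : T.ATorsor φ) : ATorsor.act T φ a t = t ↔ a = 1 := by
  constructor
  · intro h
    obtain ⟨a₀, c, rfl⟩ := ATorsor.exists_act_ofClass_eq T φ t
    have h' : ATorsor.mk T φ (a * a₀) c = ATorsor.mk T φ a₀ c := by
      have := h
      rw [← ATorsor.act_mul] at this
      simpa only [ATorsor.ofClass, ATorsor.act_mk, mul_one] using this
    obtain ⟨k, hk, hc⟩ := (ATorsor.mk_eq_mk_iff T φ _ _ _ _).mp h'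
    have hk1 : k = 1 := (T.act_eq_self_iff k c).mp hc.symm
    rw [hk1, map_one, inv_one, mul_one] at hk
    -- `a₀ = a · a₀`
    exact mul_right_cancel (a := a) (b := a₀) (by rw [← hk, one_mul])
  · rintro rfl
    exact ATorsor.act_one T φ t

/-- **Def. 4.1 (i): the `A`-torsor at `x` is an `A`-torsor** — `A` acts freely and transitively on
`A ×^{(K^×)^∧} T` — PROVED from the torsor axiom of `CuspidalTorsorData`.
[cite: MochizukiGalSect2005, Def 4.1 (i) p.33] -/
theorem ATorsor.existsUnique_act_eq (t t' : T.ATorsor φ) : ∃! a : A, ATorsor.act T φ a t = t' := by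
  obtain ⟨a, ha⟩ := ATorsor.exists_act_eq T φ t t'
  refine ⟨a, ha, fun b hb => ?_⟩
  have : ATorsor.act T φ (a⁻¹ * b) t = t := by
    rw [ATorsor.act_mul, hb, ← ha, ← ATorsor.act_mul, inv_mul_cancel, ATorsor.act_one]
  have h1 : a⁻¹ * b = 1 := (ATorsor.act_eq_self_iff T φ _ t).mp this
  rw [← mul_right_inj a⁻¹, h1, inv_mul_cancel]

/-- Along an injective `φ` the structure map `c ↦ [(1, c)]` is injective.
[cite: MochizukiGalSect2005, Def 4.1 (i) p.33] -/
theorem ATorsor.ofClass_injective_of_injective (hφ : Function.Injective φ) :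
    Function.Injective (ATorsor.ofClass T φ) := by
  intro c c' h
  obtain ⟨k, hk, hc⟩ := (ATorsor.mk_eq_mk_iff T φ 1 1 c c').mp h
  rw [one_mul, eq_comm, inv_eq_one, ← map_one φ] at hk
  rw [hc, hφ hk, T.act_one]

/-- Along a surjective `φ` the structure map is surjective. [cite: MochizukiGalSect2005, Def 4.1 (i) p.33] -/
theorem ATorsor.ofClass_surjective_of_surjective (hφ : Function.Surjective φ) :
    Function.Surjective (ATorsor.ofClass T φ) := by
  intro t
  obtain ⟨a, c, rfl⟩ := ATorsor.exists_act_ofClass_eq T φ t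
  obtain ⟨k, rfl⟩ := hφ a
  exact ⟨T.act k c, ATorsor.ofClass_act T φ k c⟩

end ATorsor

/-- For `φ = id` the `(K^×)^∧`-torsor at `x` of Def. 4.1 (i) IS the torsor of splitting classes: the
structure map is a bijection. [cite: MochizukiGalSect2005, Def 4.1 (i) p.33] -/
theorem ATorsor.ofClass_bijective_id :
    Function.Bijective (ATorsor.ofClass T (MonoidHom.id (KxHat X))) :=
  ⟨ATorsor.ofClass_injective_of_injective T _ fun _ _ h => h,
    ATorsor.ofClass_surjective_of_surjective T _ fun a => ⟨a, rfl⟩⟩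

/-! ### Def. 4.1 (i)(ii): orbit structures exist and are nonempty -/

/-- A `B`-structure is nonempty. [cite: MochizukiGalSect2005, Def 4.1 (i) p.34] -/
theorem IsStructure.nonempty {B : Subgroup (KxHat X)} {R : Set (SplittingClass X x)}
    (h : T.IsStructure B R) : R.Nonempty := by
  obtain ⟨c, hc, -⟩ := h
  exact ⟨c, hc⟩

/-- The `B`-orbit of any class is a `B`-structure. [cite: MochizukiGalSect2005, Def 4.1 (i) p.34] -/
theorem isStructure_orbit (B : Subgroup (KxHat X)) (c : SplittingClass X x) :
    T.IsStructure B {c' | ∃ b ∈ B, c' = T.act b c} :=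
  ⟨c, ⟨1, B.one_mem, (T.act_one c).symm⟩, rfl⟩

/-- A `B`-structure is the `B`-orbit of EACH of its members (not only of the chosen one).
[cite: MochizukiGalSect2005, Def 4.1 (i) p.34] -/
theorem IsStructure.eq_orbit_of_mem {B : Subgroup (KxHat X)} {R : Set (SplittingClass X x)}
    (h : T.IsStructure B R) {c : SplittingClass X x} (hc : c ∈ R) :
    R = {c' | ∃ b ∈ B, c' = T.act b c} := by
  obtain ⟨c₀, -, rfl⟩ := h
  obtain ⟨b₀, hb₀, rfl⟩ := hc
  ext c'
  constructor
  · rintro ⟨b, hb, rfl⟩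
    exact ⟨b * b₀⁻¹, B.mul_mem hb (B.inv_mem hb₀), by rw [← T.act_mul, inv_mul_cancel_right]⟩
  · rintro ⟨b, hb, rfl⟩
    exact ⟨b * b₀, B.mul_mem hb hb₀, by rw [T.act_mul]⟩

/-- **Def. 4.1 (ii): integral structures exist** — the `O_K^×`-orbit of any splitting class is an integral
structure on `D_x`. [cite: MochizukiGalSect2005, Def 4.1 (ii) p.34] -/
theorem isIntegralStructure_orbit (c : SplittingClass X x) :
    T.IsIntegralStructure {c' | ∃ b ∈ unitsHat X, c' = T.act b c} :=
  T.isStructure_orbit (unitsHat X) c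

/-- **Def. 4.1 (ii): discrete structures exist** — the `K^×`-orbit of any splitting class is a discrete
structure on `D_x`. [cite: MochizukiGalSect2005, Def 4.1 (ii) p.34] -/
theorem isDiscreteStructure_orbit (c : SplittingClass X x) :
    T.IsDiscreteStructure {c' | ∃ b ∈ discreteHat X, c' = T.act b c} :=
  T.isStructure_orbit (discreteHat X) c

/-- An integral structure refines the discrete structure it spans (`O_K^× ⊆ K^×`): `R ⊆ discreteOf R`,
and `discreteOf R` is a discrete structure. [cite: MochizukiGalSect2005, Def 4.1 (ii) p.34] -/
theorem IsIntegralStructure.subset_discreteOf {R : Set (SplittingClass X x)} (_h : T.IsIntegralStructure R) :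
    R ⊆ T.discreteOf R := fun c hc =>
  ⟨c, hc, 1, (discreteHat X).one_mem, (T.act_one c).symm⟩

/-- `discreteOf` of an integral structure is a discrete structure.
[cite: MochizukiGalSect2005, Def 4.1 (ii) p.34] -/
theorem IsIntegralStructure.isDiscreteStructure_discreteOf {R : Set (SplittingClass X x)}
    (h : T.IsIntegralStructure R) : T.IsDiscreteStructure (T.discreteOf R) := by
  obtain ⟨c, hc, hR⟩ := h
  refine ⟨c, ⟨c, hc, 1, (discreteHat X).one_mem, (T.act_one c).symm⟩, ?_⟩
  ext c'
  constructor
  · rintro ⟨c₁, hc₁, b, hb, rfl⟩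
    rw [hR] at hc₁
    obtain ⟨u, hu, rfl⟩ := hc₁
    -- `u ∈ O_K^× ⊆ K^×`
    have hu' : u ∈ discreteHat X := by
      obtain ⟨v, -, rfl⟩ := hu
      exact ⟨v, rfl⟩
    exact ⟨b * u, (discreteHat X).mul_mem hb hu', by rw [T.act_mul]⟩
  · rintro ⟨b, hb, rfl⟩
    exact ⟨c, hc, b, hb, rfl⟩

end CuspidalTorsorData

end GalSect

/-! ### [EtTh] Thm. 1.6 (iii), «reduction of indeterminacy from `(K̈^×)^∧` to `O^×_K̈`» at a cusp -/

namespace ThetaSetting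

namespace CuspidalPointDd

variable {p : ℕ} [Fact p.Prime] {D : ThetaSetting p} {E : D.KummerData} (y : CuspidalPointDd E)

/-- Evaluating `kumYdd(a) · x` at the cusp multiplies the value by `a` (`evalAt` is a homomorphism
normalised on Kummer classes of constants). [cite: MochizukiEtTh2009, Prop 1.4 (iii) p.22] -/
theorem evalAt_res_kum_mul (a : E.KddHat) (x : D.H1 D.GtpYdd) :
    y.evalAt (ContH1.res D.toTheta D.DeltaTheta (y.sec_le.trans y.Dpt_le)
        (D.inflTheta D.GtpYdd (E.kumYdd a) * x)) =
      a * y.evalAt (ContH1.res D.toTheta D.DeltaTheta (y.sec_le.trans y.Dpt_le) x) := by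
  rw [map_mul, map_mul, y.evalAt_kum]

/-- **[EtTh] Thm. 1.6 (iii) proof, p.251 (PDF p.25) l.31–38 — reduction of indeterminacy from `(K̈^×)^∧`
to `O^×_K̈`** (sub-DAG row L15 «ReductionToUnits»): if `x₂ = kumYdd(a) · x₁` for `a ∈ (K̈^×)^∧` and both
classes evaluate at the cusp `y` (through the section compatible with the canonical integral structure)
to `u₁ · v₁`, `u₂ · v₂` with `u₁, u₂ ∈ O^×_K̈` and `‖v₁‖ = ‖v₂‖` (the values of `Θ̈` at corresponding cusps:
Prop. 1.4 (iii) on either side, transported along `γ`, which preserves absolute values), then `a` lies in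
(the image of) `O^×_K̈` — PROVED from the carrier's two laws (`evalAt` multiplicative, `evalAt_kum`) and the
injectivity of `K̈^× → (K̈^×)^∧`. [cite: MochizukiEtTh2009, Thm 1.6 (iii) p.25] -/
theorem kum_factor_mem_units_of_cuspValues (a : E.KddHat) (x₁ : D.H1 D.GtpYdd)
    {u₁ u₂ v₁ v₂ : (↥D.Kdd)ˣ} (hu₁ : u₁ ∈ D.unitsOKdd) (hu₂ : u₂ ∈ D.unitsOKdd)
    (hv : ‖((v₁ : D.Kdd) : PadicAlgCl p)‖ = ‖((v₂ : D.Kdd) : PadicAlgCl p)‖)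
    (h₁ : y.evalAt (ContH1.res D.toTheta D.DeltaTheta (y.sec_le.trans y.Dpt_le) x₁) =
      E.toKddHat (u₁ * v₁))
    (h₂ : y.evalAt (ContH1.res D.toTheta D.DeltaTheta (y.sec_le.trans y.Dpt_le)
        (D.inflTheta D.GtpYdd (E.kumYdd a) * x₁)) = E.toKddHat (u₂ * v₂)) :
    ∃ u ∈ D.unitsOKdd, a = E.toKddHat u := by
  -- the evaluation of `kumYdd(a) · x₁` is `a · (u₁ v₁)`; compare with `u₂ v₂`
  have key := y.evalAt_res_kum_mul a x₁
  rw [h₂, h₁] at key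
  -- `key : toKddHat (u₂ * v₂) = a * toKddHat (u₁ * v₁)`
  refine ⟨u₂ * v₂ * (u₁ * v₁)⁻¹, ?_, ?_⟩
  · -- absolute value: `‖u₂‖ ‖v₂‖ (‖u₁‖ ‖v₁‖)⁻¹ = 1`
    have hu₁' : ‖((u₁ : D.Kdd) : PadicAlgCl p)‖ = 1 := hu₁
    have hu₂' : ‖((u₂ : D.Kdd) : PadicAlgCl p)‖ = 1 := hu₂
    have hv₁ : ‖((v₁ : D.Kdd) : PadicAlgCl p)‖ ≠ 0 := by
      rw [norm_ne_zero_iff]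
      intro h0
      apply v₁.ne_zero
      exact_mod_cast h0
    have hcoe : ((↑(u₂ * v₂ * (u₁ * v₁)⁻¹) : D.Kdd) : PadicAlgCl p) =
        ((u₂ : D.Kdd) : PadicAlgCl p) * ((v₂ : D.Kdd) : PadicAlgCl p) *
          (((u₁ : D.Kdd) : PadicAlgCl p) * ((v₁ : D.Kdd) : PadicAlgCl p))⁻¹ := by
      rw [Units.val_mul, Units.val_inv_eq_inv_val, Units.val_mul]
      push_cast
      rfl
    show ‖((↑(u₂ * v₂ * (u₁ * v₁)⁻¹) : D.Kdd) : PadicAlgCl p)‖ = 1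
    rw [hcoe, norm_mul, norm_mul, norm_inv, norm_mul, hu₁', hu₂', hv, one_mul]
    exact mul_inv_cancel₀ (hv ▸ hv₁)
  · rw [map_mul E.toKddHat (u₂ * v₂), map_inv, key, mul_inv_cancel_right]

end CuspidalPointDd

end ThetaSetting

end Literature.AnabelianGeometry.EtaleTheta
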